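import Literature.NumberTheory.EllipticCurves.PAdicOneVariableMahlerMasses
import Literature.NumberTheory.EllipticCurves.ProfiniteGroupDistribution
import HarnessLib

/-!
# `κ mod p^{n+1}` maps `U_0` ONTO `(1 + pℤ_p)/(1 + p^{n+1}ℤ_p)` as soon as `[U_0 : U_n] = p^n`
# (the index form of the surjectivity input `hκ` of `ProfiniteGroupDistributionCharacterCells.lean`)

De Shalit 1987, II.1.7–1.9 (p. 41–43) / II.4.6 (p. 59): for `𝔭` split in the imaginary quadratic
field `K` and `w_𝔣 = 1`, `Gal(K(𝔣𝔭^{n+1})/K(𝔣𝔭)) ≅ (1 + 𝔭𝒪_𝔭)/(1 + 𝔭^{n+1}𝒪_𝔭)` via the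
`𝔭`-adic character `κ`; class field theory delivers this as «`κ ≡ 1 mod 𝔭^{n+1}` cuts out the
layer» plus the DEGREE `[K(𝔣𝔭^{n+1}) : K(𝔣𝔭)] = p^n`, and surjectivity follows by counting.

This file is that counting, for an abstract character `κ : G →* ℤ_p^×` and subgroup tower `𝒰`:
* `ker_unitsMap_card` : the kernel of `(ℤ/p^{n+1})^× → (ℤ/p)^×` has `p^n` elements;
* **`exists_toZModPow_character_eq_of_relIndex`**: (`hU`) `σ ∈ U_n ↔ σ ∈ U_0 ∧ κ σ ≡ 1 mod p^{n+1}`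
  and (`hidx`) `[U_0 : U_n] = p^n` ⟹ (`hκ`) every `u ∈ ℤ_p^×` with `u ≡ 1 mod p` is
  `≡ κ(σ) mod p^{n+1}` for some `σ ∈ U_0` — the hypothesis `hκ` of
  `SubgroupTower.cellMap_fiberSurj` / `exists_cell_cellMap_eq` VERBATIM;
* `exists_toZModPow_character_eq_of_forall_exists_eq`: the same from the strong form
  «`κ : U_0 → 1 + pℤ_p` is onto» (de Shalit's (9): `κ` an isomorphism).

Everything is a theorem; no definitions, no named facts, no instances, no `sorry`.

## References

* [deShalit1987] E. de Shalit, *Iwasawa theory of elliptic curves with complex multiplication* (1987),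
  I.3.3 (9) (p. 18), II.1.7–1.9 (p. 41–43), II.4.6 (p. 59).
-/

noncomputable section

open scoped Classical

namespace Literature.NumberTheory.EllipticCurves

section Padic

variable {p : ℕ} [Fact p.Prime]

/-- `|(ℤ/p^{m+1})^×| = p^m (p - 1)`. [cite: deShalit1987, II.1.7 (p. 41)] -/
theorem PadicInt.natCard_units_zmod_pow_succ (m : ℕ) :
    Nat.card (ZMod (p ^ (m + 1)))ˣ = p ^ m * (p - 1) := by
  have hp : p.Prime := Fact.out
  haveI : NeZero (p ^ (m + 1)) := ⟨pow_ne_zero _ hp.ne_zero⟩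
  rw [Nat.card_eq_fintype_card, ZMod.card_units_eq_totient, Nat.totient_prime_pow_succ hp]

/-- **The kernel of `(ℤ/p^{n+1})^× → (ℤ/p)^×` — the classes `≡ 1 mod p` — has `p^n` elements.**
[cite: deShalit1987, II.1.7 (p. 41)] -/
theorem PadicInt.natCard_ker_unitsMap (n : ℕ) :
    Nat.card (ZMod.unitsMap (pow_dvd_pow p (Nat.le_add_left 1 n)) :
      (ZMod (p ^ (n + 1)))ˣ →* (ZMod (p ^ 1))ˣ).ker = p ^ n := by
  have hp : p.Prime := Fact.out
  haveI : NeZero (p ^ (n + 1)) := ⟨pow_ne_zero _ hp.ne_zero⟩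
  set f : (ZMod (p ^ (n + 1)))ˣ →* (ZMod (p ^ 1))ˣ :=
    ZMod.unitsMap (pow_dvd_pow p (Nat.le_add_left 1 n)) with hf
  have hsurj : Function.Surjective f := ZMod.unitsMap_surjective _
  have h1 : f.ker.index = Nat.card (ZMod (p ^ 1))ˣ := by
    rw [Subgroup.index_ker, MonoidHom.range_eq_top_of_surjective f hsurj, Subgroup.card_top]
  have h2 := Subgroup.card_mul_index f.ker
  rw [h1, PadicInt.natCard_units_zmod_pow_succ (p := p) n,
    PadicInt.natCard_units_zmod_pow_succ (p := p) 0, pow_zero, one_mul] at h2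
  have hp1 : 0 < p - 1 := Nat.sub_pos_of_lt hp.one_lt
  exact Nat.eq_of_mul_eq_mul_right hp1 h2

end Padic

namespace SubgroupTower

variable {G : Type*} [Group G] (𝒰 : SubgroupTower G) {p : ℕ} [Fact p.Prime] (κ : G →* ℤ_[p]ˣ)

/-- The strong form of de Shalit's (9) — «`κ : U_0 → 1 + pℤ_p` is onto» — gives the surjectivity
input `hκ` of the cell maps at every level. [cite: deShalit1987, I.3.3 (9) (p. 18)] -/
theorem exists_toZModPow_character_eq_of_forall_exists_eq
    (h : ∀ u : ℤ_[p]ˣ, PadicInt.toZModPow 1 (u : ℤ_[p]) = 1 → ∃ σ ∈ 𝒰.U 0, κ σ = u)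
    (n : ℕ) (u : ℤ_[p]ˣ) (hu : PadicInt.toZModPow 1 (u : ℤ_[p]) = 1) :
    ∃ σ ∈ 𝒰.U 0, PadicInt.toZModPow (n + 1) (κ σ : ℤ_[p]) = PadicInt.toZModPow (n + 1) (u : ℤ_[p]) := by
  obtain ⟨σ, hσ, hσu⟩ := h u hu
  exact ⟨σ, hσ, by rw [hσu]⟩

/-- **Surjectivity by counting**: if the tower is cut out by `κ` inside `U_0`
(`σ ∈ U_n ↔ σ ∈ U_0 ∧ κ σ ≡ 1 mod p^{n+1}`) and `[U_0 : U_n] = p^n`, then `κ mod p^{n+1}` maps `U_0`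
ONTO the classes `≡ 1 mod p`: every `u ∈ ℤ_p^×` with `u ≡ 1 mod p` is `≡ κ(σ) mod p^{n+1}` for some
`σ ∈ U_0` (the hypothesis `hκ` of `SubgroupTower.cellMap_fiberSurj`). (`κ mod p^{n+1}` embeds
`U_0/U_n` into the kernel of `(ℤ/p^{n+1})^× → (ℤ/p)^×`, and both have `p^n` elements.)
[cite: deShalit1987, II.1.7–1.9 (p. 41–43), II.4.6 (p. 59)] -/
theorem exists_toZModPow_character_eq_of_relIndex
    (hU : ∀ (n : ℕ) (σ : G), σ ∈ 𝒰.U n ↔ σ ∈ 𝒰.U 0 ∧ PadicInt.toZModPow (n + 1) (κ σ : ℤ_[p]) = 1)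
    (hidx : ∀ n, (𝒰.U n).relIndex (𝒰.U 0) = p ^ n)
    (n : ℕ) (u : ℤ_[p]ˣ) (hu : PadicInt.toZModPow 1 (u : ℤ_[p]) = 1) :
    ∃ σ ∈ 𝒰.U 0, PadicInt.toZModPow (n + 1) (κ σ : ℤ_[p]) = PadicInt.toZModPow (n + 1) (u : ℤ_[p]) := by
  have hp : p.Prime := Fact.out
  haveI : NeZero (p ^ (n + 1)) := ⟨pow_ne_zero _ hp.ne_zero⟩
  -- `f = κ mod p^{n+1}` on `U_0`, `r` = reduction to `(ℤ/p)^×`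
  set f : 𝒰.U 0 →* (ZMod (p ^ (n + 1)))ˣ :=
    (Units.map (PadicInt.toZModPow (p := p) (n + 1)).toMonoidHom).comp (κ.comp (𝒰.U 0).subtype)
    with hf_def
  set r : (ZMod (p ^ (n + 1)))ˣ →* (ZMod (p ^ 1))ˣ :=
    ZMod.unitsMap (pow_dvd_pow p (Nat.le_add_left 1 n)) with hr_def
  have hf : ∀ σ : 𝒰.U 0, ((f σ : (ZMod (p ^ (n + 1)))ˣ) : ZMod (p ^ (n + 1))) =
      PadicInt.toZModPow (n + 1) (κ (σ : G) : ℤ_[p]) := fun σ ↦ rfl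
  have hr : ∀ w : (ZMod (p ^ (n + 1)))ˣ, ((r w : (ZMod (p ^ 1))ˣ) : ZMod (p ^ 1)) =
      ZMod.castHom (pow_dvd_pow p (Nat.le_add_left 1 n)) (ZMod (p ^ 1)) (w : ZMod (p ^ (n + 1))) :=
    fun w ↦ rfl
  -- kernel of `f` = `U_n`
  have hker : f.ker = (𝒰.U n).subgroupOf (𝒰.U 0) := by
    ext σ
    rw [MonoidHom.mem_ker, Subgroup.mem_subgroupOf, hU n, ← Units.val_eq_one, hf]
    exact ⟨fun h ↦ ⟨σ.2, h⟩, fun h ↦ h.2⟩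
  -- image of `f` ≤ kernel of `r`
  have hle : f.range ≤ r.ker := by
    rintro w ⟨σ, rfl⟩
    rw [MonoidHom.mem_ker, ← Units.val_eq_one, hr, hf, ZMod.castHom_apply,
      PadicInt.cast_toZModPow 1 (n + 1) (Nat.le_add_left 1 n)]
    exact ((hU 0 (σ : G)).mp σ.2).2
  -- both have `p^n` elements
  have hcard_range : Nat.card f.range = p ^ n := by
    rw [← Subgroup.index_ker, hker]
    exact hidx n
  have hcard_ker : Nat.card r.ker = p ^ n := PadicInt.natCard_ker_unitsMap n
  have heq : f.range = r.ker :=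
    Subgroup.eq_of_le_of_card_ge hle (by rw [hcard_range, hcard_ker])
  -- `u mod p^{n+1}` lies in `ker r`, hence in the image of `f`
  have hmem : BoundedDistribution.unitMod (n + 1) u ∈ r.ker := by
    rw [MonoidHom.mem_ker, ← Units.val_eq_one, hr, BoundedDistribution.coe_unitMod,
      ZMod.castHom_apply, PadicInt.cast_toZModPow 1 (n + 1) (Nat.le_add_left 1 n), hu]
  rw [← heq] at hmem
  obtain ⟨σ, hσ⟩ := hmem
  refine ⟨σ, σ.2, ?_⟩
  rw [← hf, hσ, BoundedDistribution.coe_unitMod]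

end SubgroupTower

end Literature.NumberTheory.EllipticCurves

end
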